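import Literature.AlgebraicGeometry.Motives.HodgeStructureLefschetzGroupRestrictionToRepresentativesPoints
import Literature.AlgebraicGeometry.Motives.HodgeStructureCentralizerInternalBlocksRestrictionPoints
import HarnessLib

/-!
# PROP. 1.5 ON `K`-POINTS ALONG THE BLOCKS OF AN INTERNAL DIRECT SUM, WITH FORMULAS: for every field `K ⊇ ℚ`, restriction to the
# base-changed blocks is an injective homomorphism `S(H, ψ)(K) ↪ Π_k S(W_k, ψ|_{W_k})(K)`, `(ι_k)_K ((r g)_k x) = g ((ι_k)_K x)`, an
# isomorphism iff the blocks are Hom-orthogonal iff every `K`-family lifts — «`S'(A) ≅ S(A)_{/k'}`», «an immediate consequence of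
# Proposition 1.1» (Milne 1999 §1 p. 643 L13–L15, p. 644 L16–L28, Prop. 1.5, Remark 1.6)

[topic AlgebraicGeometry/Motives]

Layer `Literature/AlgebraicGeometry/Motives`, lane `lit-hodgefound` (Track 2 foundations library; prover seat
`lit-hodgefound-p02`, generation 53, self-proposed row g53-#11). THEOREMS ONLY: no definition, no named fact (net debt `0`),
no instance, no notation.  The `K`-points companion, WITH FORMULAS, of g52-#4 (`Motives/HodgeStructureLefschetzGroupInternalBlocks`:
`S(H)(ℚ) ↪ Π_k S(W_k)(ℚ)`, `≃` for Hom-orthogonal blocks) and of §3 of g52-#7 (`Motives/HodgeStructureInternalBlocksHomOrthogonalityCriterion`);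
g52-#9 (`Motives/HodgeStructureLefschetzGroupInternalBlocksPoints`) has the `K`-point isomorphisms only as bare `Nonempty`.  Deduced — as
Milne deduces Prop. 1.5 from Prop. 1.1 — from the `C`-side of g53-#10 (`Motives/HodgeStructureCentralizerInternalBlocksRestrictionPoints`:
`r : C(H)(K) ↪ Π_k C(W_k)(K)` and `C(H)(K) ≃ₐ Π_k C(W_k)(K)` over the restrictions, `†_K`-compatible) through the functoriality of
`S(·)(K) = {γ ∈ C(·)(K) | γ†γ = 1}` in the `K`-algebra with involution (g53-#7,
`Motives/HodgeStructureLefschetzGroupRestrictionToRepresentativesPoints`, here completed for HOMOMORPHISMS); «⟹ Hom = 0» is Milne's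
block-sign argument on `K`-points (p34's `Polarization.neg_mem_lefschetzGroupBaseChange`) — all BY NAME, nothing restated.

## The source, verbatim

J. S. Milne, *Lefschetz classes on abelian varieties*, Duke Math. J. 96 (1999) 639–675 [Milne1999LefschetzClasses] (held
`paper:doi-10-1215-s0012-7094-99-09620-5`), §1 p. 643 L13–L15: "If `B` is isogenous to `A₁ × ⋯ × A_s`, then
`C(B) ⊂ C(A₁) × ⋯ × C(A_s)`, with equality holding if and only if `Hom(Aᵢ, Aⱼ) = 0` for all `i ≠ j`."; p. 644 L16–L28:
"`S(A)(R) = {γ ∈ C(A) ⊗_k R | γ†γ = 1}` […] **Proposition 1.5.** […] Any such isogeny induces an isomorphism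
`S(A₁) × ⋯ × S(A_s) → S(A)`, which is independent of the choice of the isogeny. *Proof.* This is an immediate consequence of
Proposition 1.1."; L29–L34: "**Remark 1.6.** […] canonical isomorphisms `C'(A) ≅ C(A) ⊗_k k'`, `S'(A) ≅ S(A)_{/k'}`."  Also H. Lange
[Lange2023AbelianVarietiesComplex] §7.2.4 Exercise (4), B. Moonen [Moonen2004MT] §4 Lemma 4.6, C. Voisin [VoisinHodgeI2002] §7.3.1
Lemma 7.26.

## Dictionary and what is proved (namespace `Literature.AlgebraicGeometry.Motives.HodgeStructure`)

`S(H, Q)(K) = Q.lefschetzGroupBaseChange K ≤ GL(K ⊗_ℚ V)`, `C(H)(K) = Subalgebra.centralizer K {a_K : a ∈ E_φ(H)}`,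
`(ι_k)_K = (W k).toSubmodule.subtype.baseChange K`, `†_K = Q.adjointBaseChange K` (`Q.centralizerAdjoint K` on `C(H)(K)`).

* §1 **`Polarization.exists_monoidHom_pi_lefschetzGroupBaseChange_of_algHom_centralizerAdjoint`** (a HOMOMORPHISM of `K`-algebras
  `R : C(H)(K) → Π_k C(H_k)(K)` with `(R c^{†})_k = ((R c)_k)^{†_k}` induces `r : S(H)(K) →* Π_k S(H_k)(K)`, `↑((r g)_k) = (R ↑g)_k`,
  injective when `R` is).
* §2 (internal `V = ⊕_k W_k`) `Polarization.lefschetzGroupBaseChange_pi_eq_of_forall_subtype_baseChange_apply_eq` («independent of the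
  choice»), `Polarization.subtype_baseChange_apply_eq_symm_apply_of_forall_subtype_baseChange_apply_eq` (the inverse glues),
  **`Polarization.exists_monoidHom_pi_lefschetzGroupBaseChange`** (INJECTIVE restriction `r : S(H)(K) →* Π_k S(W_k)(K)`,
  `(ι_k)_K ((r g)_k x) = g ((ι_k)_K x)`), **`Polarization.exists_mulEquiv_pi_lefschetzGroupBaseChange_of_hom_orthogonal`** (PROP. 1.5 ON
  `K`-POINTS along Hom-orthogonal blocks, with formula), `Polarization.exists_mulEquiv_pi_lefschetzGroupBaseChange_of_forall_stable`,
  **`Polarization.hom_eq_zero_of_forall_exists_lefschetzGroupBaseChange_lift`** (lift `(−1, 1, …, 1)`: Milne's argument on `K`-points),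
  **`Polarization.forall_exists_lefschetzGroupBaseChange_lift_iff_hom_orthogonal`**,
  **`Polarization.exists_mulEquiv_pi_lefschetzGroupBaseChange_iff_hom_orthogonal`**,
  `Polarization.existsUnique_mem_lefschetzGroupBaseChange_forall_subtype_baseChange_apply_eq_of_hom_orthogonal`.
* §3 `Polarization.exists_mulEquiv_pi_lefschetzGroupBaseChange_minimal_stable` (over the CANONICAL blocks of a polarized `H`).
-/

noncomputable section

open scoped TensorProduct

namespace Literature.AlgebraicGeometry.Motives

namespace HodgeStructure

universe u u' u'' uK

variable (K : Type uK) [Field K] [Algebra ℚ K]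

/-! ## §1 `S(·)(K)` is functorial for homomorphisms of `K`-algebras with involution into products -/

section Functorial

variable {V₁ : Type u} [AddCommGroup V₁] [Module ℚ V₁] [Module.Finite ℚ V₁] {n₁ : ℤ} {H₁ : HodgeStructure V₁ n₁}
  {κ : Type u''} {W : κ → Type u'} [∀ k, AddCommGroup (W k)] [∀ k, Module ℚ (W k)] [∀ k, Module.Finite ℚ (W k)]
  {m : κ → ℤ} {H' : ∀ k, HodgeStructure (W k) (m k)}

/-- **`S(·)(K) = {γ ∈ C(·)(K) | γ†γ = 1}` is functorial for HOMOMORPHISMS of `K`-algebras with involution into products**: a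
`K`-algebra homomorphism `R : C(H)(K) → Π_k C(H_k)(K)` with `(R c^{†})_k = ((R c)_k)^{†_k}` induces a group homomorphism
`r : S(H, Q)(K) →* Π_k S(H_k, Q_k)(K)` lying over it, `↑((r g)_k) = (R ↑g)_k` (each `(R ↑g)_k` is unitary, hence an automorphism of the
finite-dimensional `K ⊗ W_k` in `S(H_k)(K)`), injective as soon as `R` is. [cite: Milne1999LefschetzClasses, §1 p. 643 L13–L15, p. 644 L16–L21 and Prop. 1.5]
[cite: Lange2023AbelianVarietiesComplex, §7.2.4 Exercise (4)] -/
theorem Polarization.exists_monoidHom_pi_lefschetzGroupBaseChange_of_algHom_centralizerAdjoint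
    (Q : Polarization H₁) (Q' : ∀ k, Polarization (H' k))
    (R : Subalgebra.centralizer K ((fun a : Module.End ℚ V₁ => a.baseChange K) '' (H₁.endAlg : Set (Module.End ℚ V₁))) →ₐ[K]
      Π k, Subalgebra.centralizer K ((fun a : Module.End ℚ (W k) => a.baseChange K) '' ((H' k).endAlg : Set (Module.End ℚ (W k)))))
    (hR : ∀ (c : Subalgebra.centralizer K ((fun a : Module.End ℚ V₁ => a.baseChange K) '' (H₁.endAlg : Set (Module.End ℚ V₁))))
      (k : κ),
      ((R (Q.centralizerAdjoint K c) k : Subalgebra.centralizer K ((fun a : Module.End ℚ (W k) => a.baseChange K) ''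
          ((H' k).endAlg : Set (Module.End ℚ (W k))))) : Module.End K (K ⊗[ℚ] W k)) =
        (Q' k).adjointBaseChange K ((R c k : Subalgebra.centralizer K ((fun a : Module.End ℚ (W k) => a.baseChange K) ''
          ((H' k).endAlg : Set (Module.End ℚ (W k))))) : Module.End K (K ⊗[ℚ] W k))) :
    ∃ r : Q.lefschetzGroupBaseChange K →* Π k, (Q' k).lefschetzGroupBaseChange K,
      (∀ (g : Q.lefschetzGroupBaseChange K) (k : κ),
        (((r g k : (Q' k).lefschetzGroupBaseChange K) : (K ⊗[ℚ] W k) ≃ₗ[K] (K ⊗[ℚ] W k)) : Module.End K (K ⊗[ℚ] W k)) =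
          ((R ⟨((g : (K ⊗[ℚ] V₁) ≃ₗ[K] (K ⊗[ℚ] V₁)) : Module.End K (K ⊗[ℚ] V₁)),
              Q.coe_mem_centralizer_of_mem_lefschetzGroupBaseChange K g.2⟩ k : Subalgebra.centralizer K
                ((fun a : Module.End ℚ (W k) => a.baseChange K) '' ((H' k).endAlg : Set (Module.End ℚ (W k))))) :
            Module.End K (K ⊗[ℚ] W k))) ∧
      (Function.Injective R → Function.Injective r) := by
  obtain ⟨cH, hcH⟩ : ∃ cH : Q.lefschetzGroupBaseChange K →
      Subalgebra.centralizer K ((fun a : Module.End ℚ V₁ => a.baseChange K) '' (H₁.endAlg : Set (Module.End ℚ V₁))),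
      ∀ g, (cH g : Module.End K (K ⊗[ℚ] V₁)) = ((g : (K ⊗[ℚ] V₁) ≃ₗ[K] (K ⊗[ℚ] V₁)) : Module.End K (K ⊗[ℚ] V₁)) :=
    ⟨fun g => ⟨_, Q.coe_mem_centralizer_of_mem_lefschetzGroupBaseChange K g.2⟩, fun _ => rfl⟩
  have hR' : ∀ c k, R (Q.centralizerAdjoint K c) k = (Q' k).centralizerAdjoint K (R c k) := fun c k => Subtype.ext (hR c k)
  have huH : ∀ g, Q.centralizerAdjoint K (cH g) * cH g = 1 := fun g => by
    rw [Q.centralizerAdjoint_mul_self_eq_one_iff K, hcH]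
    exact ((Q.mem_lefschetzGroupBaseChange_iff_adjointBaseChange_mul_self_eq_one K _).1 g.2).2
  -- `(R ↑g)_k` is unitary for every `k`
  have hfwd : ∀ g k, (Q' k).centralizerAdjoint K (R (cH g) k) * R (cH g) k = 1 := fun g k => by
    rw [← hR', ← Pi.mul_apply, ← map_mul, huH, map_one, Pi.one_apply]
  choose f hfS hf using fun g k => (Q' k).exists_mem_lefschetzGroupBaseChange_coe_eq K (hfwd g k)
  have hmul : ∀ g g', cH (g * g') = cH g * cH g' := fun g g' => Subtype.ext (by
    rw [hcH, Subalgebra.coe_mul, hcH, hcH, Subgroup.coe_mul, LinearEquiv.coe_toLinearMap_mul])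
  have hone : cH 1 = 1 := Subtype.ext (by rw [hcH, Subalgebra.coe_one, Subgroup.coe_one]; rfl)
  refine ⟨{ toFun := fun g k => ⟨f g k, hfS g k⟩
            map_one' := ?_
            map_mul' := fun g g' => ?_ }, fun g k => ?_, fun hinj g g' h => ?_⟩
  · funext k
    apply Subtype.ext
    apply LinearEquiv.toLinearMap_injective
    change ((f 1 k : (K ⊗[ℚ] W k) ≃ₗ[K] (K ⊗[ℚ] W k)) : Module.End K (K ⊗[ℚ] W k)) =
      (((1 : (Q' k).lefschetzGroupBaseChange K) : (K ⊗[ℚ] W k) ≃ₗ[K] (K ⊗[ℚ] W k)) : Module.End K (K ⊗[ℚ] W k))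
    rw [hf, hone, map_one, Pi.one_apply, Subalgebra.coe_one, Subgroup.coe_one]
    rfl
  · funext k
    apply Subtype.ext
    apply LinearEquiv.toLinearMap_injective
    change ((f (g * g') k : (K ⊗[ℚ] W k) ≃ₗ[K] (K ⊗[ℚ] W k)) : Module.End K (K ⊗[ℚ] W k)) =
      ((f g k * f g' k : (K ⊗[ℚ] W k) ≃ₗ[K] (K ⊗[ℚ] W k)) : Module.End K (K ⊗[ℚ] W k))
    rw [hf, hmul, map_mul, Pi.mul_apply, Subalgebra.coe_mul, LinearEquiv.coe_toLinearMap_mul, hf, hf]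
  · change ((f g k : (K ⊗[ℚ] W k) ≃ₗ[K] (K ⊗[ℚ] W k)) : Module.End K (K ⊗[ℚ] W k)) = _
    have hg : cH g = ⟨_, Q.coe_mem_centralizer_of_mem_lefschetzGroupBaseChange K g.2⟩ := Subtype.ext (hcH g)
    rw [hf, hg]
  · -- injectivity: `R ↑g = R ↑g'` forces `↑g = ↑g'`
    have hRg : R (cH g) = R (cH g') := funext fun k => Subtype.ext (by
      rw [← hf, ← hf]
      exact congrArg (fun δ : Π k, (Q' k).lefschetzGroupBaseChange K =>
        (((δ k : (Q' k).lefschetzGroupBaseChange K) : (K ⊗[ℚ] W k) ≃ₗ[K] (K ⊗[ℚ] W k)) : Module.End K (K ⊗[ℚ] W k))) h)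
    exact Subtype.ext (LinearEquiv.toLinearMap_injective (by rw [← hcH, ← hcH, hinj hRg]))

end Functorial

/-! ## §2 Restriction to the base-changed blocks of an internal direct sum -/

section Blocks

variable {V : Type u} [AddCommGroup V] [Module ℚ V] {n : ℤ} {H : HodgeStructure V n} (ψ : Polarization H)
  {κ : Type*} [Fintype κ] [DecidableEq κ] (W : κ → SubHodgeStructure H) (hW : DirectSum.IsInternal fun k => (W k).toSubmodule)

omit [Fintype κ] [DecidableEq κ] in
/-- **«independent of the choice of the isogeny»**, on `K`-points: two maps `F, F' : S(H)(K) → Π_k S(W_k)(K)` over the base-changed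
restrictions COINCIDE (`(ι_k)_K` is injective, `K` being flat over `ℚ`). [cite: Milne1999LefschetzClasses, §1 p. 644 L20–L21, Prop. 1.5 and Remark 1.6]
[cite: BourbakiAlgebraI1989, Ch. II §5 no. 3 Prop. 7] -/
theorem Polarization.lefschetzGroupBaseChange_pi_eq_of_forall_subtype_baseChange_apply_eq
    (F F' : ψ.lefschetzGroupBaseChange K → Π k, (ψ.restrict (W k)).lefschetzGroupBaseChange K)
    (hF : ∀ (g : ψ.lefschetzGroupBaseChange K) (k : κ) (x : K ⊗[ℚ] (W k).toSubmodule),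
      (W k).toSubmodule.subtype.baseChange K
          ((F g k : (K ⊗[ℚ] (W k).toSubmodule) ≃ₗ[K] (K ⊗[ℚ] (W k).toSubmodule)) x) =
        (g : (K ⊗[ℚ] V) ≃ₗ[K] (K ⊗[ℚ] V)) ((W k).toSubmodule.subtype.baseChange K x))
    (hF' : ∀ (g : ψ.lefschetzGroupBaseChange K) (k : κ) (x : K ⊗[ℚ] (W k).toSubmodule),
      (W k).toSubmodule.subtype.baseChange K
          ((F' g k : (K ⊗[ℚ] (W k).toSubmodule) ≃ₗ[K] (K ⊗[ℚ] (W k).toSubmodule)) x) =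
        (g : (K ⊗[ℚ] V) ≃ₗ[K] (K ⊗[ℚ] V)) ((W k).toSubmodule.subtype.baseChange K x)) :
    F = F' := by
  have hinj : ∀ k, Function.Injective ((W k).toSubmodule.subtype.baseChange K) := fun k => by
    rw [LinearMap.baseChange_eq_ltensor]
    exact Module.Flat.lTensor_preserves_injective_linearMap _ (W k).toSubmodule.injective_subtype
  exact funext fun g => funext fun k => Subtype.ext (LinearEquiv.ext fun x => hinj k (by rw [hF, hF']))

omit [Fintype κ] [DecidableEq κ] in
/-- **The inverse GLUES**: for an isomorphism `F : S(H)(K) ≃* Π_k S(W_k)(K)` over the base-changed restrictions, `F⁻¹ δ` restricts to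
`δ_k` on each `K ⊗ W_k`. [cite: Milne1999LefschetzClasses, §1 Prop. 1.5 and Remark 1.6 (p. 644)] -/
theorem Polarization.subtype_baseChange_apply_eq_symm_apply_of_forall_subtype_baseChange_apply_eq
    (F : ψ.lefschetzGroupBaseChange K ≃* Π k, (ψ.restrict (W k)).lefschetzGroupBaseChange K)
    (hF : ∀ (g : ψ.lefschetzGroupBaseChange K) (k : κ) (x : K ⊗[ℚ] (W k).toSubmodule),
      (W k).toSubmodule.subtype.baseChange K
          ((F g k : (K ⊗[ℚ] (W k).toSubmodule) ≃ₗ[K] (K ⊗[ℚ] (W k).toSubmodule)) x) =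
        (g : (K ⊗[ℚ] V) ≃ₗ[K] (K ⊗[ℚ] V)) ((W k).toSubmodule.subtype.baseChange K x))
    (δ : Π k, (ψ.restrict (W k)).lefschetzGroupBaseChange K) (k : κ) (x : K ⊗[ℚ] (W k).toSubmodule) :
    (W k).toSubmodule.subtype.baseChange K ((δ k : (K ⊗[ℚ] (W k).toSubmodule) ≃ₗ[K] (K ⊗[ℚ] (W k).toSubmodule)) x) =
      ((F.symm δ : ψ.lefschetzGroupBaseChange K) : (K ⊗[ℚ] V) ≃ₗ[K] (K ⊗[ℚ] V)) ((W k).toSubmodule.subtype.baseChange K x) := by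
  rw [← hF (F.symm δ) k x, MulEquiv.apply_symm_apply]

include hW

variable [Module.Finite ℚ V]

/-- **«`S(B) ⊂ S(A₁) × ⋯ × S(A_s)`» ON `K`-POINTS: restriction to the base-changed blocks is an INJECTIVE group homomorphism
`r : S(H, ψ)(K) →* Π_k S(W_k, ψ|_{W_k})(K)`, `(ι_k)_K ((r g)_k x) = g ((ι_k)_K x)`**, for every internal direct sum `V = ⊕_k W_k` of
sub-Hodge structures — induced (§1) by the injective `†_K`-compatible restriction `C(H)(K) ↪ Π_k C(W_k)(K)` of g53-#10.
[cite: Milne1999LefschetzClasses, §1 p. 643 L13–L15, p. 644 L16–L21 and Remark 1.6] [cite: Moonen2004MT, §4 Lemma 4.6] -/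
theorem Polarization.exists_monoidHom_pi_lefschetzGroupBaseChange :
    ∃ r : ψ.lefschetzGroupBaseChange K →* Π k, (ψ.restrict (W k)).lefschetzGroupBaseChange K,
      (∀ (g : ψ.lefschetzGroupBaseChange K) (k : κ) (x : K ⊗[ℚ] (W k).toSubmodule),
        (W k).toSubmodule.subtype.baseChange K
            ((r g k : (K ⊗[ℚ] (W k).toSubmodule) ≃ₗ[K] (K ⊗[ℚ] (W k).toSubmodule)) x) =
          (g : (K ⊗[ℚ] V) ≃ₗ[K] (K ⊗[ℚ] V)) ((W k).toSubmodule.subtype.baseChange K x)) ∧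
      Function.Injective r := by
  obtain ⟨R, hR, hRinj⟩ := exists_algHom_pi_centralizer_baseChange K W hW
  obtain ⟨r, hr, hrinj⟩ := ψ.exists_monoidHom_pi_lefschetzGroupBaseChange_of_algHom_centralizerAdjoint K
    (H' := fun k => (W k).toHodgeStructure) (fun k => ψ.restrict (W k)) R
    fun c k => ψ.coe_map_centralizerAdjoint_eq_adjointBaseChange_of_forall_subtype_baseChange_apply_eq K W R hR c k
  refine ⟨r, fun g k x => ?_, hrinj hRinj⟩
  have h := LinearMap.congr_fun (hr g k) x
  rw [LinearEquiv.coe_coe] at h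
  rw [h, hR]
  rfl

/-- **MILNE'S PROPOSITION 1.5 ON `K`-POINTS ALONG HOM-ORTHOGONAL BLOCKS, CANONICAL FORM: restriction to the base-changed blocks is an
isomorphism of groups `F : S(H, ψ)(K) ≃* Π_k S(W_k, ψ|_{W_k})(K)`, `(ι_k)_K ((F g)_k x) = g ((ι_k)_K x)`** — induced (g53-#7 §1) by the
restriction isomorphism of `K`-algebras with involution `C(H)(K) ≃ₐ[K] Π_k C(W_k)(K)` of g53-#10 («an immediate consequence of
Proposition 1.1»). [cite: Milne1999LefschetzClasses, §1 Prop. 1.5 and Remark 1.6 (p. 644), p. 643 L13–L15] [cite: Lange2023AbelianVarietiesComplex, §7.2.4 Exercise (4)] -/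
theorem Polarization.exists_mulEquiv_pi_lefschetzGroupBaseChange_of_hom_orthogonal
    (horth : ∀ k l, k ≠ l → ∀ f : Hom (W k).toHodgeStructure (W l).toHodgeStructure, f = 0) :
    ∃ F : ψ.lefschetzGroupBaseChange K ≃* Π k, (ψ.restrict (W k)).lefschetzGroupBaseChange K,
      ∀ (g : ψ.lefschetzGroupBaseChange K) (k : κ) (x : K ⊗[ℚ] (W k).toSubmodule),
        (W k).toSubmodule.subtype.baseChange K
            ((F g k : (K ⊗[ℚ] (W k).toSubmodule) ≃ₗ[K] (K ⊗[ℚ] (W k).toSubmodule)) x) =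
          (g : (K ⊗[ℚ] V) ≃ₗ[K] (K ⊗[ℚ] V)) ((W k).toSubmodule.subtype.baseChange K x) := by
  obtain ⟨E, hE, hadj⟩ := ψ.exists_algEquiv_pi_centralizer_baseChange_adjoint_of_hom_orthogonal K W hW horth
  obtain ⟨F, hF⟩ := ψ.exists_mulEquiv_pi_lefschetzGroupBaseChange_of_algEquiv_centralizerAdjoint K
    (H' := fun k => (W k).toHodgeStructure) (fun k => ψ.restrict (W k)) E hadj
  refine ⟨F, fun g k x => ?_⟩
  have h := LinearMap.congr_fun (hF g k) x
  rw [LinearEquiv.coe_coe] at h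
  rw [h, hE]
  rfl

/-- **`S(H)(K) ≃* Π_k S(W_k)(K)` by restriction along an internal direct sum into `E_φ`-STABLE sub-Hodge structures** (stable blocks are
Hom-orthogonal, g52-#3). [cite: Milne1999LefschetzClasses, §1 Prop. 1.5 and Remark 1.6 (p. 644)] -/
theorem Polarization.exists_mulEquiv_pi_lefschetzGroupBaseChange_of_forall_stable
    (hst : ∀ k, ∀ a ∈ H.endAlg, ∀ v ∈ (W k).toSubmodule, a v ∈ (W k).toSubmodule) :
    ∃ F : ψ.lefschetzGroupBaseChange K ≃* Π k, (ψ.restrict (W k)).lefschetzGroupBaseChange K,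
      ∀ (g : ψ.lefschetzGroupBaseChange K) (k : κ) (x : K ⊗[ℚ] (W k).toSubmodule),
        (W k).toSubmodule.subtype.baseChange K
            ((F g k : (K ⊗[ℚ] (W k).toSubmodule) ≃ₗ[K] (K ⊗[ℚ] (W k).toSubmodule)) x) =
          (g : (K ⊗[ℚ] V) ≃ₗ[K] (K ⊗[ℚ] V)) ((W k).toSubmodule.subtype.baseChange K x) :=
  ψ.exists_mulEquiv_pi_lefschetzGroupBaseChange_of_hom_orthogonal K W hW fun _ _ hkl f => hom_eq_zero_of_forall_stable W hW hst hkl f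

omit [Fintype κ] [Module.Finite ℚ V] in
/-- **«equality holding ⟹ `Hom(Aᵢ, Aⱼ) = 0`» for `S`, on `K`-points** (Milne's block-sign argument, verbatim on `K`-points): if EVERY
family `(δ_k ∈ S(W_k, ψ|_{W_k})(K))_k` is the family of restrictions of some `g ∈ S(H, ψ)(K)`, the blocks are Hom-orthogonal — lift
`(−1_{K ⊗ W_k}, 1, …, 1)` to `g`; `g` commutes with `a_K`, `a = ι_l ∘ f ∘ π_k ∈ E_φ` for a morphism `f : W_k → W_l`, so
`(ι_l)_K (f_K x) = g (a_K ((ι_k)_K x)) = a_K (g ((ι_k)_K x)) = −(ι_l)_K (f_K x)`, whence `f_K = 0` and `f = 0`.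
[cite: Milne1999LefschetzClasses, §1 p. 643 L13–L15, Prop. 1.5 and Remark 1.6 (p. 644)] [cite: VoisinHodgeI2002, §7.3.1 Lemma 7.26] -/
theorem Polarization.hom_eq_zero_of_forall_exists_lefschetzGroupBaseChange_lift
    (hlift : ∀ δ : Π k, (ψ.restrict (W k)).lefschetzGroupBaseChange K, ∃ g ∈ ψ.lefschetzGroupBaseChange K,
      ∀ (k : κ) (x : K ⊗[ℚ] (W k).toSubmodule),
        (W k).toSubmodule.subtype.baseChange K ((δ k : (K ⊗[ℚ] (W k).toSubmodule) ≃ₗ[K] (K ⊗[ℚ] (W k).toSubmodule)) x) =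
          g ((W k).toSubmodule.subtype.baseChange K x))
    {k l : κ} (hkl : k ≠ l) (f : Hom (W k).toHodgeStructure (W l).toHodgeStructure) : f = 0 := by
  obtain ⟨g, hg, hgx⟩ := hlift (Pi.mulSingle k ⟨LinearEquiv.neg K, (ψ.restrict (W k)).neg_mem_lefschetzGroupBaseChange K⟩)
  obtain ⟨a, ha, hax⟩ := exists_mem_endAlg_apply_coe_eq W hW k l f
  have haι : a ∘ₗ (W k).toSubmodule.subtype = (W l).toSubmodule.subtype ∘ₗ f.toLinearMap := LinearMap.ext fun x => hax x
  -- `g = −1` on `K ⊗ W_k`, `g = 1` on `K ⊗ W_l`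
  have h1 : ∀ x : K ⊗[ℚ] (W k).toSubmodule,
      g ((W k).toSubmodule.subtype.baseChange K x) = -((W k).toSubmodule.subtype.baseChange K x) := fun x => by
    rw [← hgx k x, Pi.mulSingle_eq_same, ← map_neg]
    rfl
  have h2 : ∀ y : K ⊗[ℚ] (W l).toSubmodule,
      g ((W l).toSubmodule.subtype.baseChange K y) = (W l).toSubmodule.subtype.baseChange K y := fun y => by
    rw [← hgx l y, Pi.mulSingle_eq_of_ne' hkl]
    rfl
  -- `g` commutes with `a_K`, and `a_K ∘ (ι_k)_K = (ι_l)_K ∘ f_K`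
  have haK : ∀ x : K ⊗[ℚ] (W k).toSubmodule,
      a.baseChange K ((W k).toSubmodule.subtype.baseChange K x) = (W l).toSubmodule.subtype.baseChange K (f.toLinearMap.baseChange K x) :=
    fun x => by
      rw [← LinearMap.comp_apply (a.baseChange K), ← LinearMap.baseChange_comp, haι, LinearMap.baseChange_comp, LinearMap.comp_apply]
  have hfK : ∀ x : K ⊗[ℚ] (W k).toSubmodule, (W l).toSubmodule.subtype.baseChange K (f.toLinearMap.baseChange K x) = 0 := fun x => by
    have h := hg.1 ⟨a, ha⟩ ((W k).toSubmodule.subtype.baseChange K x)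
    change a.baseChange K (g ((W k).toSubmodule.subtype.baseChange K x)) = g (a.baseChange K ((W k).toSubmodule.subtype.baseChange K x)) at h
    rw [h1, map_neg, haK, h2] at h
    -- `-z = z` forces `z = 0` in a `ℚ`-vector space
    have h2z : (2 : ℚ) • (W l).toSubmodule.subtype.baseChange K (f.toLinearMap.baseChange K x) = 0 := by
      rw [two_smul]
      nth_rw 1 [← h]
      exact neg_add_cancel _
    exact (smul_eq_zero.1 h2z).resolve_left two_ne_zero
  have hι : Function.Injective ((W l).toSubmodule.subtype.baseChange K) := by
    rw [LinearMap.baseChange_eq_ltensor]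
    exact Module.Flat.lTensor_preserves_injective_linearMap _ (W l).toSubmodule.injective_subtype
  refine Hom.ext (LinearMap.ext fun v => ?_)
  have h0 : f.toLinearMap.baseChange K ((1 : K) ⊗ₜ[ℚ] v) = 0 := hι (by rw [hfK, map_zero])
  rw [LinearMap.baseChange_tmul] at h0
  rw [Hom.zero_toLinearMap, LinearMap.zero_apply]
  exact eq_zero_of_one_tmul_eq_zero K h0

/-- **«`S(A) = S(A₁) × ⋯ × S(A_s)` if and only if `Hom(Aᵢ, Aⱼ) = 0`», lifting form on `K`-points**: every family
`(δ_k ∈ S(W_k, ψ|_{W_k})(K))_k` lifts to `S(H, ψ)(K)` iff the blocks are Hom-orthogonal. [cite: Milne1999LefschetzClasses, §1 p. 643 L13–L15, Prop. 1.5 and Remark 1.6 (p. 644)] -/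
theorem Polarization.forall_exists_lefschetzGroupBaseChange_lift_iff_hom_orthogonal :
    (∀ δ : Π k, (ψ.restrict (W k)).lefschetzGroupBaseChange K, ∃ g ∈ ψ.lefschetzGroupBaseChange K,
      ∀ (k : κ) (x : K ⊗[ℚ] (W k).toSubmodule),
        (W k).toSubmodule.subtype.baseChange K ((δ k : (K ⊗[ℚ] (W k).toSubmodule) ≃ₗ[K] (K ⊗[ℚ] (W k).toSubmodule)) x) =
          g ((W k).toSubmodule.subtype.baseChange K x)) ↔
      ∀ k l, k ≠ l → ∀ f : Hom (W k).toHodgeStructure (W l).toHodgeStructure, f = 0 := by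
  refine ⟨fun hlift _ _ hkl f => ψ.hom_eq_zero_of_forall_exists_lefschetzGroupBaseChange_lift K W hW hlift hkl f, fun horth δ => ?_⟩
  obtain ⟨F, hF⟩ := ψ.exists_mulEquiv_pi_lefschetzGroupBaseChange_of_hom_orthogonal K W hW horth
  exact ⟨(F.symm δ : ψ.lefschetzGroupBaseChange K), (F.symm δ).2, fun k x =>
    ψ.subtype_baseChange_apply_eq_symm_apply_of_forall_subtype_baseChange_apply_eq K W F hF δ k x⟩

/-- **«with equality holding if and only if `Hom(Aᵢ, Aⱼ) = 0`» for `S`, isomorphism form on `K`-points**: there is an isomorphism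
`S(H, ψ)(K) ≃* Π_k S(W_k, ψ|_{W_k})(K)` lying over the base-changed restrictions iff the blocks are Hom-orthogonal.
[cite: Milne1999LefschetzClasses, §1 Prop. 1.5 and Remark 1.6 (p. 644), p. 643 L13–L15] -/
theorem Polarization.exists_mulEquiv_pi_lefschetzGroupBaseChange_iff_hom_orthogonal :
    (∃ F : ψ.lefschetzGroupBaseChange K ≃* Π k, (ψ.restrict (W k)).lefschetzGroupBaseChange K,
      ∀ (g : ψ.lefschetzGroupBaseChange K) (k : κ) (x : K ⊗[ℚ] (W k).toSubmodule),
        (W k).toSubmodule.subtype.baseChange K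
            ((F g k : (K ⊗[ℚ] (W k).toSubmodule) ≃ₗ[K] (K ⊗[ℚ] (W k).toSubmodule)) x) =
          (g : (K ⊗[ℚ] V) ≃ₗ[K] (K ⊗[ℚ] V)) ((W k).toSubmodule.subtype.baseChange K x)) ↔
      ∀ k l, k ≠ l → ∀ f : Hom (W k).toHodgeStructure (W l).toHodgeStructure, f = 0 := by
  refine ⟨fun ⟨F, hF⟩ => (ψ.forall_exists_lefschetzGroupBaseChange_lift_iff_hom_orthogonal K W hW).1 fun δ => ?_,
    fun horth => ψ.exists_mulEquiv_pi_lefschetzGroupBaseChange_of_hom_orthogonal K W hW horth⟩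
  exact ⟨(F.symm δ : ψ.lefschetzGroupBaseChange K), (F.symm δ).2, fun k x =>
    ψ.subtype_baseChange_apply_eq_symm_apply_of_forall_subtype_baseChange_apply_eq K W F hF δ k x⟩

/-- **Every family `δ_k ∈ S(W_k, ψ|_{W_k})(K)` along Hom-orthogonal blocks is the family of restrictions of a UNIQUE `g ∈ S(H, ψ)(K)`**
(bijectivity of restriction, spelled out on `GL(K ⊗ V)`). [cite: Milne1999LefschetzClasses, §1 Prop. 1.5 and Remark 1.6 (p. 644)] -/
theorem Polarization.existsUnique_mem_lefschetzGroupBaseChange_forall_subtype_baseChange_apply_eq_of_hom_orthogonal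
    (horth : ∀ k l, k ≠ l → ∀ f : Hom (W k).toHodgeStructure (W l).toHodgeStructure, f = 0)
    (δ : Π k, (ψ.restrict (W k)).lefschetzGroupBaseChange K) :
    ∃! g : (K ⊗[ℚ] V) ≃ₗ[K] (K ⊗[ℚ] V), g ∈ ψ.lefschetzGroupBaseChange K ∧
      ∀ (k : κ) (x : K ⊗[ℚ] (W k).toSubmodule),
        (W k).toSubmodule.subtype.baseChange K ((δ k : (K ⊗[ℚ] (W k).toSubmodule) ≃ₗ[K] (K ⊗[ℚ] (W k).toSubmodule)) x) =
          g ((W k).toSubmodule.subtype.baseChange K x) := by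
  obtain ⟨F, hF⟩ := ψ.exists_mulEquiv_pi_lefschetzGroupBaseChange_of_hom_orthogonal K W hW horth
  have hinj : ∀ k, Function.Injective ((W k).toSubmodule.subtype.baseChange K) := fun k => by
    rw [LinearMap.baseChange_eq_ltensor]
    exact Module.Flat.lTensor_preserves_injective_linearMap _ (W k).toSubmodule.injective_subtype
  refine ⟨(F.symm δ : ψ.lefschetzGroupBaseChange K), ⟨(F.symm δ).2, fun k x =>
    ψ.subtype_baseChange_apply_eq_symm_apply_of_forall_subtype_baseChange_apply_eq K W F hF δ k x⟩, fun g' hg' => ?_⟩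
  obtain ⟨hg'S, hg'⟩ := hg'
  have h : F ⟨g', hg'S⟩ = δ := funext fun k => Subtype.ext (LinearEquiv.ext fun x => hinj k (by rw [hF, hg']))
  have h' : (⟨g', hg'S⟩ : ψ.lefschetzGroupBaseChange K) = F.symm δ := by rw [← h, MulEquiv.symm_apply_apply]
  exact congrArg Subtype.val h'

end Blocks

/-! ## §3 Over the canonical blocks of a polarized `H` -/

section Canonical

variable {V : Type u} [AddCommGroup V] [Module ℚ V] [Module.Finite ℚ V] {n : ℤ} {H : HodgeStructure V n}

open Classical in
/-- **`S(H, ψ)(K) ≃* Π_S S(S, ψ|_S)(K)` BY RESTRICTION OVER THE CANONICAL BLOCKS** — Prop. 1.5 on `K`-points, intrinsically, with its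
formula: along the decomposition of a polarized finite-dimensional `ℚ`-Hodge structure into its minimal `E_φ`-stable sub-Hodge structures
(Hom-orthogonal, g51). [cite: Milne1999LefschetzClasses, §1 Prop. 1.5 and Remark 1.6 (p. 644)] [cite: Lange2023AbelianVarietiesComplex, §2.4.4 Cor. 2.4.26 (p. 124)] -/
theorem Polarization.exists_mulEquiv_pi_lefschetzGroupBaseChange_minimal_stable (ψ : Polarization H) :
    ∃ F : ψ.lefschetzGroupBaseChange K ≃*
        Π S : {S : SubHodgeStructure H // (∀ a ∈ H.endAlg, ∀ v ∈ S.toSubmodule, a v ∈ S.toSubmodule) ∧ S.toSubmodule ≠ ⊥ ∧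
          ∀ S' : SubHodgeStructure H, (∀ a ∈ H.endAlg, ∀ v ∈ S'.toSubmodule, a v ∈ S'.toSubmodule) →
            S'.toSubmodule ≤ S.toSubmodule → S'.toSubmodule = ⊥ ∨ S'.toSubmodule = S.toSubmodule},
          (ψ.restrict (S : SubHodgeStructure H)).lefschetzGroupBaseChange K,
      ∀ (g : ψ.lefschetzGroupBaseChange K)
        (S : {S : SubHodgeStructure H // (∀ a ∈ H.endAlg, ∀ v ∈ S.toSubmodule, a v ∈ S.toSubmodule) ∧ S.toSubmodule ≠ ⊥ ∧
          ∀ S' : SubHodgeStructure H, (∀ a ∈ H.endAlg, ∀ v ∈ S'.toSubmodule, a v ∈ S'.toSubmodule) →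
            S'.toSubmodule ≤ S.toSubmodule → S'.toSubmodule = ⊥ ∨ S'.toSubmodule = S.toSubmodule})
        (x : K ⊗[ℚ] (S : SubHodgeStructure H).toSubmodule),
        (S : SubHodgeStructure H).toSubmodule.subtype.baseChange K
            ((F g S : (K ⊗[ℚ] (S : SubHodgeStructure H).toSubmodule) ≃ₗ[K] (K ⊗[ℚ] (S : SubHodgeStructure H).toSubmodule)) x) =
          (g : (K ⊗[ℚ] V) ≃ₗ[K] (K ⊗[ℚ] V)) ((S : SubHodgeStructure H).toSubmodule.subtype.baseChange K x) := by
  haveI : Fintype {S : SubHodgeStructure H // (∀ a ∈ H.endAlg, ∀ v ∈ S.toSubmodule, a v ∈ S.toSubmodule) ∧ S.toSubmodule ≠ ⊥ ∧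
      ∀ S' : SubHodgeStructure H, (∀ a ∈ H.endAlg, ∀ v ∈ S'.toSubmodule, a v ∈ S'.toSubmodule) →
        S'.toSubmodule ≤ S.toSubmodule → S'.toSubmodule = ⊥ ∨ S'.toSubmodule = S.toSubmodule} :=
    ψ.finite_setOf_minimal_stable.fintype
  exact ψ.exists_mulEquiv_pi_lefschetzGroupBaseChange_of_hom_orthogonal K
    (Subtype.val : {S : SubHodgeStructure H // (∀ a ∈ H.endAlg, ∀ v ∈ S.toSubmodule, a v ∈ S.toSubmodule) ∧ S.toSubmodule ≠ ⊥ ∧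
      ∀ S' : SubHodgeStructure H, (∀ a ∈ H.endAlg, ∀ v ∈ S'.toSubmodule, a v ∈ S'.toSubmodule) →
        S'.toSubmodule ≤ S.toSubmodule → S'.toSubmodule = ⊥ ∨ S'.toSubmodule = S.toSubmodule} → SubHodgeStructure H)
    ψ.isInternal_minimal_stable
    fun S S' hne f => ψ.hom_eq_zero_of_minimal_stable_of_ne S.2 S'.2 (fun h => hne (Subtype.ext h)) f

end Canonical

end HodgeStructure

end Literature.AlgebraicGeometry.Motives
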